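import Literature.NumberTheory.QuadraticFields.GaussCountDirichletSeries
import Literature.NumberTheory.QuadraticFields.QuadraticDedekindZetaKronecker
import Literature.NumberTheory.QuadraticFields.KroneckerCharacterExists
import Literature.NumberTheory.QuadraticFields.DedekindZetaReducedForms
import HarnessLib

/-!
# `ζ_K(s) = ζ(2s) Σ r_n(−d) n^{−s}` (Oesterlé 1988, II §2, (23), second equality), via (25) and (26)

Topic `NumberTheory/QuadraticFields`, namespace `Literature.NumberTheory.QuadraticFields.Quadratic`
(continuing `GaussCountDirichletSeries.lean`: (25) `Σ ρ_d(n) n^{−s} = Π_p (1 + p^{−s})/(1 − χ(p)p^{−s})`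
and «ou encore (26)» `ζ(2s) Σ ρ_d(n) n^{−s} = ζ(s) L(κ, s)` for any Dirichlet character `κ` with the
Kronecker values `(−d/p)` at primes). Everything here is PROVED (theorems only; no definitions, no
named facts).

J. Oesterlé, *Le problème de Gauss sur le nombre de classes*, Enseign. Math. (2) 34 (1988), II §2,
p. 56 (page image `HOME/goldfeld/lit-scans/oesterle1988-p56.jpg`):

> «(23) ζ_K(s) = Σ_{C ∈ Cl(−d)} ζ(C, s) = ζ(2s) Σ_{n=1}^{∞} r_n(−d) n^{−s} … (25) Σ_{n=1}^{∞} r_n(−d) n^{−s}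
> = Π_{p premier} ((1 + p^{−s})/(1 − χ(p) p^{−s})) ou encore, compte tenu de (24) [the step uses
> (23)], l'égalité (26) ζ_K(s) = ζ(s) L(χ, s).»

Here the character is made CONCRETE: for every quadratic field `K` the tree's Kronecker character
`κ` (`KroneckerCharacterExists.exists_kroneckerChar`: `κ(p) = J(d_K | p)` at odd primes, `κ(2) = 1,
−1, 0` as `d_K ≡ 1, 5 (mod 8)`, `2 ∣ d_K` — Cox Lemma 1.14), for which the tree proves (26)
`ζ_K = ζ · L(κ)` for BOTH parities (`dedekindZeta_eq_riemannZeta_mul_LSeries_of_kronecker`,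
`QuadraticDedekindZetaKronecker.lean`), HAS the prime values required in
`BinQF.riemannZeta_mul_LSeries_card_sqrtsMod` (`kroneckerChar_prime_eq_*`, via the Jacobi-symbol
lemmas of `GaussCountDirichletSeries.lean`); and for an ODD fundamental `−d` the explicit character
`jacobiChar d = (· / d)` (`JacobiCharacter.lean`; `= (−d / ·)` by quadratic reciprocity
`jacobiSym_natAbs_eq_of_emod_four_eq_one` and the supplements at `2`) likewise. With
`ρ_d(n) = #{0 ≤ b < 2n : 4n ∣ b² + d}` (`= r_n(−d)`, Théorème p. 54):

* `jacobiChar_prime_eq_zero_of_dvd`, `jacobiChar_prime_eq_one_of_mem`,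
  `jacobiChar_prime_eq_neg_one_of_not_mem`, `riemannZeta_mul_LSeries_card_sqrtsMod_eq_mul_LSeries_jacobiChar`
  — odd fundamental `−d`: `ζ(2s) · Σ ρ_d(n) n^{−s} = ζ(s) · L(jacobiChar d, s)` (`Re s > 1`);
* `kroneckerChar_prime_eq_zero_of_dvd`, `kroneckerChar_prime_eq_one_of_mem`,
  `kroneckerChar_prime_eq_neg_one_of_not_mem` — any quadratic `K`: a Kronecker character `κ` of `K`
  takes the values `0 / 1 / −1` at `p` according as `p ∣ d_K` / `p ∈ 𝒫_{d_K} = kroneckerOnePrimes d_K`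
  / otherwise;
* **`dedekindZeta_eq_riemannZeta_two_mul_mul_LSeries_card_sqrtsMod`** — **(23), second equality, as
  printed, field side, every imaginary quadratic field**: `[K : ℚ] = 2`, `d_K < 0`, `d = |d_K|`,
  `Re s > 1` ⇒ `ζ_K(s) = ζ(2s) · Σ_{n ≥ 1} ρ_d(n) n^{−s}`;
* **`half_sum_epsteinZeta_eq_riemannZeta_two_mul_mul_LSeries_card_sqrtsMod`** — **(23) in full on the
  forms side**, every negative fundamental `−d < −4`: `½ Σ_{Q reduced, disc Q = −d} ζ_Q(s) =
  ζ(2s) · Σ ρ_d(n) n^{−s}` (`ζ_Q(s) = Σ_{(m,n) ≠ 0} Q(m,n)^{−s}` = the tree's `epsteinZeta`, so `½ ζ_Q`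
  is Oesterlé's `ζ(C, s)`, II §2 (16)), with the tree's first equality `ζ_K = ½ Σ_Q ζ_Q`
  (`dedekindZeta_eq_half_sum_epsteinZeta`, `DedekindZetaReducedForms.lean`) for a quadratic field of
  discriminant `−d` (`exists_numberField_discr_eq`).

## References

* [Oesterle1988Gauss] J. Oesterlé, Enseign. Math. (2) 34 (1988), II §2, (23), (25), (26) p. 56.
* [Cox2013] D. A. Cox, *Primes of the form x² + ny²*, 2nd ed., §1.C Lemma 1.14 (the Kronecker symbol
  of a fundamental discriminant), §7 Thm. 7.7 (forms ↔ ideals).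
-/




namespace Literature.NumberTheory.QuadraticFields.Quadratic

section OddFundamental

open Finset Complex Module
open scoped LSeries.notation NumberTheorySymbols
open Literature.NumberTheory.QuadraticFields.BinaryQuadraticForm (kroneckerOnePrimes
  prime_of_mem_kroneckerOnePrimes not_dvd_of_mem_kroneckerOnePrimes two_mem_kroneckerOnePrimes_iff
  jacobiSym_eq_one_of_mem_kroneckerOnePrimes jacobiSym_eq_neg_one_of_not_mem_kroneckerOnePrimes)

/-! ### The Kronecker values at primes of the tree's `jacobiChar d` (`−d ≡ 1 (mod 4)`) -/

/-- For `−d ≡ 1 (mod 4)` and a prime `p ∣ d`: `χ(p) = 0`, `χ = jacobiChar d = (· / d)`.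
[cite: Cox2013, §1.C Lemma 1.14] -/
theorem jacobiChar_prime_eq_zero_of_dvd {d : ℕ} [NeZero d] {p : ℕ} (hp : p.Prime) (hpd : p ∣ d) :
    jacobiChar d p = 0 :=
  jacobiChar_natCast_eq_zero_of_dvd hpd hp.one_lt.ne'

/-- For `−d ≡ 1 (mod 4)` and a prime `p ∈ 𝒫_{−d}` (`(−d/p) = 1`): `(p / d) = 1`, i.e.
`jacobiChar d p = 1` — quadratic reciprocity `J(p | |D|) = J(D | p)` for odd `p`
(`jacobiSym_natAbs_eq_of_emod_four_eq_one`) and the supplement at `2`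
(`jacobiSym_two_natAbs_eq_one_iff`). [cite: Cox2013, §1.C Lemma 1.14] -/
theorem jacobiChar_prime_eq_one_of_mem {d : ℕ} [NeZero d] (h1 : (-(d : ℤ)) % 4 = 1) {p : ℕ}
    (hP : p ∈ kroneckerOnePrimes (-(d : ℤ))) : jacobiChar d p = 1 := by
  have hp : p.Prime := prime_of_mem_kroneckerOnePrimes hP
  have hdn : (-(d : ℤ)).natAbs = d := by simp
  rw [jacobiChar_natCast]
  by_cases hp2 : p = 2
  · subst hp2
    have h8 : (-(d : ℤ)) % 8 = 1 := two_mem_kroneckerOnePrimes_iff.mp hP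
    have := (jacobiSym_two_natAbs_eq_one_iff h1).mpr h8
    rw [hdn] at this
    rw [show ((2 : ℕ) : ℤ) = 2 from rfl, this]; simp
  · have hodd : Odd p := hp.odd_of_ne_two hp2
    have hrec := jacobiSym_natAbs_eq_of_emod_four_eq_one h1 hodd
    rw [hdn] at hrec
    rw [hrec, jacobiSym_eq_one_of_mem_kroneckerOnePrimes (Or.inr h1) hp2 hP]; simp

/-- For `−d ≡ 1 (mod 4)` and a prime `p ∤ d` with `p ∉ 𝒫_{−d}` (`(−d/p) = −1`): `jacobiChar d p = −1`.
[cite: Cox2013, §1.C Lemma 1.14] -/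
theorem jacobiChar_prime_eq_neg_one_of_not_mem {d : ℕ} [NeZero d] (h1 : (-(d : ℤ)) % 4 = 1) {p : ℕ}
    (hp : p.Prime) (hpd : ¬ p ∣ d) (hP : p ∉ kroneckerOnePrimes (-(d : ℤ))) :
    jacobiChar d p = -1 := by
  have hdn : (-(d : ℤ)).natAbs = d := by simp
  rw [jacobiChar_natCast]
  by_cases hp2 : p = 2
  · subst hp2
    have h8 : (-(d : ℤ)) % 8 ≠ 1 := fun h => hP (two_mem_kroneckerOnePrimes_iff.mpr h)
    have h5 : (-(d : ℤ)) % 8 = 5 := by omega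
    have := (jacobiSym_two_natAbs_eq_neg_one_iff h1).mpr h5
    rw [hdn] at this
    rw [show ((2 : ℕ) : ℤ) = 2 from rfl, this]; simp
  · have hodd : Odd p := hp.odd_of_ne_two hp2
    have hrec := jacobiSym_natAbs_eq_of_emod_four_eq_one h1 hodd
    rw [hdn] at hrec
    have hpd' : ¬ (p : ℤ) ∣ -(d : ℤ) := by
      rw [dvd_neg]; exact fun h => hpd (Int.natCast_dvd_natCast.mp h)
    rw [hrec, jacobiSym_eq_neg_one_of_not_mem_kroneckerOnePrimes (Or.inr h1) hp hp2 hpd' hP]; simp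

/-! ### (25)·ζ(2s) = ζ(s) L(χ, s) with the tree's `χ = jacobiChar d` -/

/-- **«ou encore … (26)» with the tree's Kronecker character**: for an odd negative fundamental
discriminant `−d` (`−d ≡ 1 (mod 4)` squarefree) and `Re s > 1`,
`ζ(2s) · Σ_{n ≥ 1} ρ_d(n) n^{−s} = ζ(s) · L(χ, s)`, `χ = jacobiChar d = (· / d) = (−d / ·)`,
`ρ_d(n) = #{b (mod 2n) : b² ≡ −d (mod 4n)} = r_n(−d)`.
[cite: Oesterle1988Gauss, II §2 (25)–(26) p. 56] -/
theorem riemannZeta_mul_LSeries_card_sqrtsMod_eq_mul_LSeries_jacobiChar {d : ℕ} [NeZero d]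
    (hfd : (-(d : ℤ)) % 4 = 1 ∧ Squarefree (-(d : ℤ)) ∧ (-(d : ℤ)) ≠ 1) {s : ℂ} (hs : 1 < s.re) :
    riemannZeta (2 * s) * LSeries (fun n : ℕ => ((((range (2 * n)).filter
        (fun b : ℕ => (4 * (n : ℤ)) ∣ (b : ℤ) ^ 2 + d)).card : ℕ) : ℂ)) s =
      riemannZeta s * L ↗(jacobiChar d) s :=
  BinQF.riemannZeta_mul_LSeries_card_sqrtsMod (Or.inl hfd) (jacobiChar d)
    (fun _ hp hpd => jacobiChar_prime_eq_zero_of_dvd hp hpd)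
    (fun _ hP => jacobiChar_prime_eq_one_of_mem hfd.1 hP)
    (fun _ hp hpd hP => jacobiChar_prime_eq_neg_one_of_not_mem hfd.1 hp hpd hP) hs

end OddFundamental

/-! ### (23): `ζ_K(s) = ζ(2s) Σ r_n(−d) n^{−s}` — every imaginary quadratic field -/

section AnyFundamental

open Finset Complex Module
open scoped LSeries.notation NumberTheorySymbols
open Literature.NumberTheory.QuadraticFields.BinaryQuadraticForm (kroneckerOnePrimes
  prime_of_mem_kroneckerOnePrimes not_dvd_of_mem_kroneckerOnePrimes two_mem_kroneckerOnePrimes_iff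
  jacobiSym_eq_zero_of_prime_dvd jacobiSym_eq_one_of_mem_kroneckerOnePrimes
  jacobiSym_eq_neg_one_of_not_mem_kroneckerOnePrimes reducedForms)
open Literature.Barriers.RiemannHypothesis (epsteinZeta)

variable {K : Type*} [Field K] [NumberField K]

/-- `d_K ≡ 0, 1 (mod 4)` for a quadratic field (Stickelberger; from `isFundamentalDiscriminant_discr`).
[folklore] -/
private theorem discr_emod_four' (h2 : finrank ℚ K = 2) :
    NumberField.discr K % 4 = 0 ∨ NumberField.discr K % 4 = 1 := by
  rcases isFundamentalDiscriminant_discr (K := K) h2 with ⟨h1, -, -⟩ | ⟨⟨c, hc⟩, -, -⟩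
  · exact Or.inr h1
  · left; omega

/-- **A Kronecker character of `K` vanishes at the primes dividing `d_K`.** For `[K : ℚ] = 2` and a
Dirichlet character `κ` with `κ(p) = (d_K / p)` at odd primes and `κ(2) = 1, −1, 0` according as
`d_K ≡ 1, 5 (mod 8)` or `2 ∣ d_K` (the tree's `exists_kroneckerChar`, Cox Lemma 1.14): `κ(p) = 0`
for every prime `p ∣ d_K`. [cite: Cox2013, §1.C Lemma 1.14] -/
theorem kroneckerChar_prime_eq_zero_of_dvd (h2 : finrank ℚ K = 2) {M : ℕ}
    (κ : DirichletCharacter ℂ M)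
    (hoddp : ∀ p : ℕ, p.Prime → p ≠ 2 → κ p = (J(NumberField.discr K | p) : ℂ))
    (htwo : κ 2 = if NumberField.discr K % 8 = 1 then 1
      else if NumberField.discr K % 8 = 5 then -1 else 0)
    {p : ℕ} (hp : p.Prime) (hpd : (p : ℤ) ∣ NumberField.discr K) : κ p = 0 := by
  have _ := h2
  by_cases hp2 : p = 2
  · subst hp2
    obtain ⟨c, hc⟩ := hpd
    have h81 : ¬ NumberField.discr K % 8 = 1 := by omega
    have h85 : ¬ NumberField.discr K % 8 = 5 := by omega
    rw [Nat.cast_ofNat, htwo, if_neg h81, if_neg h85]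
  · rw [hoddp p hp hp2, jacobiSym_eq_zero_of_prime_dvd hp hpd]; simp

/-- **… is `1` at the primes of `𝒫_{d_K}`** (`(d_K / p) = 1`; at `2`: `d_K ≡ 1 (mod 8)`).
[cite: Cox2013, §1.C Lemma 1.14] -/
theorem kroneckerChar_prime_eq_one_of_mem (h2 : finrank ℚ K = 2) {M : ℕ}
    (κ : DirichletCharacter ℂ M)
    (hoddp : ∀ p : ℕ, p.Prime → p ≠ 2 → κ p = (J(NumberField.discr K | p) : ℂ))
    (htwo : κ 2 = if NumberField.discr K % 8 = 1 then 1
      else if NumberField.discr K % 8 = 5 then -1 else 0)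
    {p : ℕ} (hP : p ∈ kroneckerOnePrimes (NumberField.discr K)) : κ p = 1 := by
  have hp : p.Prime := prime_of_mem_kroneckerOnePrimes hP
  by_cases hp2 : p = 2
  · subst hp2
    have h81 : NumberField.discr K % 8 = 1 := two_mem_kroneckerOnePrimes_iff.mp hP
    rw [Nat.cast_ofNat, htwo, if_pos h81]
  · rw [hoddp p hp hp2, jacobiSym_eq_one_of_mem_kroneckerOnePrimes (discr_emod_four' h2) hp2 hP]
    simp

/-- **… and is `−1` at the remaining primes** (`p ∤ d_K`, `p ∉ 𝒫_{d_K}`; at `2`: `d_K ≡ 5 (mod 8)`).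
[cite: Cox2013, §1.C Lemma 1.14] -/
theorem kroneckerChar_prime_eq_neg_one_of_not_mem (h2 : finrank ℚ K = 2) {M : ℕ}
    (κ : DirichletCharacter ℂ M)
    (hoddp : ∀ p : ℕ, p.Prime → p ≠ 2 → κ p = (J(NumberField.discr K | p) : ℂ))
    (htwo : κ 2 = if NumberField.discr K % 8 = 1 then 1
      else if NumberField.discr K % 8 = 5 then -1 else 0)
    {p : ℕ} (hp : p.Prime) (hpd : ¬ (p : ℤ) ∣ NumberField.discr K)
    (hP : p ∉ kroneckerOnePrimes (NumberField.discr K)) : κ p = -1 := by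
  have h4 := discr_emod_four' h2
  by_cases hp2 : p = 2
  · subst hp2
    have h81 : ¬ NumberField.discr K % 8 = 1 := fun h => hP (two_mem_kroneckerOnePrimes_iff.mpr h)
    have hodd : ¬ (2 : ℤ) ∣ NumberField.discr K := by exact_mod_cast hpd
    have h85 : NumberField.discr K % 8 = 5 := by omega
    rw [Nat.cast_ofNat, htwo, if_neg h81, if_pos h85]
  · rw [hoddp p hp hp2, jacobiSym_eq_neg_one_of_not_mem_kroneckerOnePrimes h4 hp hp2 hpd hP]
    simp

/-- **Oesterlé 1988, II §2, (23), second equality, as printed — every imaginary quadratic field**: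
for `[K : ℚ] = 2` with `d_K < 0`, `d = |d_K|`, and `Re s > 1`,
`ζ_K(s) = ζ(2s) · Σ_{n ≥ 1} ρ_d(n) n^{−s}`, `ρ_d(n) = #{b (mod 2n) : b² ≡ −d (mod 4n)}`
(`= r_n(−d)` for `d > 4`, Théorème p. 54) («ζ_K(s) = Σ_{C ∈ Cl(−d)} ζ(C, s) = ζ(2s) Σ_{n=1}^∞ r_n(−d) n^{−s}»).
Route (25) + (26) as on p. 56: the tree's Kronecker character `κ` of `K` (`exists_kroneckerChar`) and
`ζ_K = ζ · L(κ)` (`dedekindZeta_eq_riemannZeta_mul_LSeries_of_kronecker`), the prime values of `κ`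
(`kroneckerChar_prime_eq_*`), and `ζ(2s) Σ ρ_d(n) n^{−s} = ζ(s) L(κ, s)`
(`BinQF.riemannZeta_mul_LSeries_card_sqrtsMod`, from (25)). [cite: Oesterle1988Gauss, II §2 (23) p. 56] -/
theorem dedekindZeta_eq_riemannZeta_two_mul_mul_LSeries_card_sqrtsMod (h2 : finrank ℚ K = 2)
    (hneg : NumberField.discr K < 0) {s : ℂ} (hs : 1 < s.re) :
    NumberField.dedekindZeta K s =
      riemannZeta (2 * s) * LSeries (fun n : ℕ => ((((range (2 * n)).filter
        (fun b : ℕ => (4 * (n : ℤ)) ∣ (b : ℤ) ^ 2 + (NumberField.discr K).natAbs)).card : ℕ) : ℂ)) s := by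
  haveI := neZero_natAbs_discr (K := K)
  obtain ⟨κ, hoddp, htwo⟩ := _root_.Literature.NumberTheory.QuadraticFields.exists_kroneckerChar h2
  rw [dedekindZeta_eq_riemannZeta_mul_LSeries_of_kronecker h2 κ hoddp htwo hs]
  have hdK : -(((NumberField.discr K).natAbs : ℕ) : ℤ) = NumberField.discr K := by omega
  have hfd : ((-(((NumberField.discr K).natAbs : ℕ) : ℤ)) % 4 = 1 ∧
      Squarefree (-(((NumberField.discr K).natAbs : ℕ) : ℤ)) ∧
        (-(((NumberField.discr K).natAbs : ℕ) : ℤ)) ≠ 1) ∨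
      (4 ∣ (-(((NumberField.discr K).natAbs : ℕ) : ℤ)) ∧
        ((-(((NumberField.discr K).natAbs : ℕ) : ℤ)) / 4 % 4 = 2 ∨
          (-(((NumberField.discr K).natAbs : ℕ) : ℤ)) / 4 % 4 = 3) ∧
        Squarefree ((-(((NumberField.discr K).natAbs : ℕ) : ℤ)) / 4)) := by
    rw [hdK]; exact isFundamentalDiscriminant_discr (K := K) h2
  refine (BinQF.riemannZeta_mul_LSeries_card_sqrtsMod hfd κ ?_ ?_ ?_ hs).symm
  · intro p hp hpd
    exact kroneckerChar_prime_eq_zero_of_dvd h2 κ hoddp htwo hp (by rw [← hdK, dvd_neg]; exact_mod_cast hpd)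
  · intro p hP
    rw [hdK] at hP
    exact kroneckerChar_prime_eq_one_of_mem h2 κ hoddp htwo hP
  · intro p hp hpd hP
    rw [hdK] at hP
    exact kroneckerChar_prime_eq_neg_one_of_not_mem h2 κ hoddp htwo hp
      (by rw [← hdK, dvd_neg]; exact_mod_cast hpd) hP

/-- **(23) in full on the forms side, every negative fundamental discriminant `−d < −4`:**
`½ Σ_{Q reduced, disc Q = −d} ζ_Q(s) = ζ(2s) · Σ_{n ≥ 1} ρ_d(n) n^{−s}` (`Re s > 1`;
`ζ_Q(s) = Σ_{(m,n) ≠ 0} Q(m,n)^{−s}` is the tree's `epsteinZeta`, `½ ζ_Q` = Oesterlé's `ζ(C, s)` of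
II §2 (16)) — «(23) ζ_K(s) = Σ_{C ∈ Cl(−d)} ζ(C, s) = ζ(2s) Σ_{n=1}^∞ r_n(−d) n^{−s}»: a quadratic
field of discriminant `−d` (`exists_numberField_discr_eq`), the tree's first equality
(`dedekindZeta_eq_half_sum_epsteinZeta`) and `dedekindZeta_eq_riemannZeta_two_mul_mul_LSeries_card_sqrtsMod`.
[cite: Oesterle1988Gauss, II §2 (23) p. 56] -/
theorem half_sum_epsteinZeta_eq_riemannZeta_two_mul_mul_LSeries_card_sqrtsMod {d : ℕ} (hd4 : 4 < d)
    (hfd : ((-(d : ℤ)) % 4 = 1 ∧ Squarefree (-(d : ℤ)) ∧ (-(d : ℤ)) ≠ 1) ∨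
      (4 ∣ (-(d : ℤ)) ∧ ((-(d : ℤ)) / 4 % 4 = 2 ∨ (-(d : ℤ)) / 4 % 4 = 3) ∧
        Squarefree ((-(d : ℤ)) / 4)))
    {s : ℂ} (hs : 1 < s.re) :
    1 / 2 * ∑ Q ∈ reducedForms (-(d : ℤ)), epsteinZeta (Q.1 : ℝ) (Q.2.1 : ℝ) (Q.2.2 : ℝ) s =
      riemannZeta (2 * s) * LSeries (fun n : ℕ => ((((range (2 * n)).filter
        (fun b : ℕ => (4 * (n : ℤ)) ∣ (b : ℤ) ^ 2 + d)).card : ℕ) : ℂ)) s := by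
  obtain ⟨K, _i1, _i2, h2, hdisc⟩ := exists_numberField_discr_eq (D := -(d : ℤ)) hfd
  have hneg : NumberField.discr K < 0 := by rw [hdisc]; omega
  have hlt : NumberField.discr K < -4 := by rw [hdisc]; omega
  have hnat : (NumberField.discr K).natAbs = d := by rw [hdisc]; simp
  rw [← hdisc, ← dedekindZeta_eq_half_sum_epsteinZeta h2 hlt hs,
    dedekindZeta_eq_riemannZeta_two_mul_mul_LSeries_card_sqrtsMod h2 hneg hs, hnat]

end AnyFundamental


end Literature.NumberTheory.QuadraticFields.Quadratic
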